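import Mathlib.Analysis.InnerProductSpace.Basic
import Mathlib.Analysis.InnerProductSpace.PiL2
import HarnessLib

/-!
# The ε-tube lemma for exact capping (E1 inner step): a first-order cone margin pins the completion

Helper for `stmt-Ventures-19480` (GenericWallFloor; per-ball programme E1 of cf-p1 ROUTE.md §80:
«inside the ε-tubes of special(O) the exact rigidity lemma»).  General form, any real inner product
space, any finite index set of free balls.

Setting.  A ball at the origin is kissed by own balls at unit vectors `o ∈ O` (fixed) and by free
balls at unit vectors `x i`, `i : ι`; non-overlap is `⟪x i, o⟫ ≤ 1/2`, `⟪x i, x j⟫ ≤ 1/2` (angle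
`≥ 60°`).  `s : ι → E` is the EXACT completion (unit vectors); a contact of `s` is ACTIVE if the
inner product is exactly `1/2`.  FIRST-ORDER CONE MARGIN `κ`: every tangent velocity field `v`
(`⟪v i, s i⟫ = 0`) violates some active contact to first order by at least `κ ‖v i₀‖`, for each
`i₀` — i.e. the strut cone of the exact completion with `O` pinned is `{0}`, quantitatively
(Connelly's first-order rigidity test for packings; certified per orbit by an LP / Farkas
certificate).

THEOREM `eq_of_coneMargin`: if `0 < κ ≤ 3` and an admissible completion `x` has every free ball
within chord distance `κ/3` of its exact slot, then `x = s`.  (Proof: with `u i = x i − s i`,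
`ε = max ‖u i‖`, the tangent part `v i = u i + (‖u i‖²/2) s i` satisfies every active linearised
constraint up to `(3/2) ε²` while `‖v i₀‖ ≥ ε/2` at the maximiser, so `κ ε/2 ≤ (3/2) ε²`.)
So the ε-tube radius of E1 is `κ/3` per ball, with NO second-order analysis.

Printed background: «a packing is rigid if and only if it is infinitesimally rigid» (Connelly,
Structural Topology 14 (1988) 43–60; 16 (1991) 57–76; quoted in Donev–Torquato–Stillinger–Connelly,
J. Comput. Phys. 197 (2004) §2, arXiv:cond-mat/0208502), «infinitesimal rigidity implies the
'rigidity' of a framework» (Bezdek–Bezdek–Connelly, DCG 20 (1998) §2.5); tensegrity frameworks: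
Roth–Whiteley, Trans. AMS 265 (1981) 419–446.  lit g11 cone census (kit j289968,
HOME/cf-lit/slotex-cone/README-CONE.md): the margin is positive for every own-pattern orbit with
`|O| ≥ 7` (fcc and hcp), so this lemma applies to every E1 row.

WHAT THIS IS NOT: the certificates `κ(O) > 0` themselves (E1, eng), nor the B&B outside the tube.
-/

noncomputable section

namespace Summit.Ventures.Crystal3D.Theorems

open scoped RealInnerProductSpace

variable {E : Type*} [NormedAddCommGroup E] [InnerProductSpace ℝ E]

/-- For unit vectors `s, x`: `⟪x − s, s⟫ = −‖x − s‖²/2`. -/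
theorem inner_sub_self_of_norm_eq_one {s x : E} (hs : ‖s‖ = 1) (hx : ‖x‖ = 1) :
    ⟪x - s, s⟫ = -(‖x - s‖ ^ 2) / 2 := by
  have h1 : ‖x - s‖ ^ 2 = ‖x‖ ^ 2 - 2 * ⟪x, s⟫ + ‖s‖ ^ 2 := norm_sub_sq_real x s
  rw [hx, hs] at h1
  rw [inner_sub_left, real_inner_self_eq_norm_sq, hs, h1]
  ring

/-- The tangent part `v = (x − s) + (‖x − s‖²/2) s` of the displacement of a unit vector is
orthogonal to `s`. -/
theorem inner_tangentPart_eq_zero {s x : E} (hs : ‖s‖ = 1) (hx : ‖x‖ = 1) :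
    ⟪(x - s) + (‖x - s‖ ^ 2 / 2) • s, s⟫ = 0 := by
  rw [inner_add_left, real_inner_smul_left, inner_sub_self_of_norm_eq_one hs hx,
    real_inner_self_eq_norm_sq, hs]
  ring

/-- Norm of the tangent part: `‖v‖² = ε² − ε⁴/4` with `ε = ‖x − s‖`. -/
theorem norm_tangentPart_sq {s x : E} (hs : ‖s‖ = 1) (hx : ‖x‖ = 1) :
    ‖(x - s) + (‖x - s‖ ^ 2 / 2) • s‖ ^ 2 = ‖x - s‖ ^ 2 - ‖x - s‖ ^ 4 / 4 := by
  rw [norm_add_sq_real, real_inner_smul_right, inner_sub_self_of_norm_eq_one hs hx, norm_smul, hs,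
    Real.norm_eq_abs, abs_of_nonneg (by positivity)]
  ring

/-- Hence `‖v‖ ≥ ε/2` when `ε ≤ 1`. -/
theorem half_norm_le_norm_tangentPart {s x : E} (hs : ‖s‖ = 1) (hx : ‖x‖ = 1)
    (hε : ‖x - s‖ ≤ 1) : ‖x - s‖ / 2 ≤ ‖(x - s) + (‖x - s‖ ^ 2 / 2) • s‖ := by
  have h0 : 0 ≤ ‖x - s‖ := norm_nonneg _
  have hsq := norm_tangentPart_sq hs hx (s := s) (x := x)
  have h4 : ‖x - s‖ ^ 4 ≤ ‖x - s‖ ^ 2 := by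
    have : ‖x - s‖ ^ 2 ≤ 1 := by nlinarith
    nlinarith
  have hle : (‖x - s‖ / 2) ^ 2 ≤ ‖(x - s) + (‖x - s‖ ^ 2 / 2) • s‖ ^ 2 := by
    rw [hsq]; nlinarith
  exact (pow_le_pow_iff_left₀ (by positivity) (norm_nonneg _) two_ne_zero).1 hle

/-- Active OWN contact: if `⟪s, o⟫ = 1/2` and `⟪x, o⟫ ≤ 1/2` then the tangent part satisfies
`⟪v, o⟫ ≤ ε²/4`. -/
theorem inner_tangentPart_own_le {s x o : E} (hso : ⟪s, o⟫ = 1 / 2) (hxo : ⟪x, o⟫ ≤ 1 / 2) :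
    ⟪(x - s) + (‖x - s‖ ^ 2 / 2) • s, o⟫ ≤ ‖x - s‖ ^ 2 / 4 := by
  rw [inner_add_left, real_inner_smul_left, inner_sub_left, hso]
  linarith

/-- Active FREE contact: if `⟪s i, s j⟫ = 1/2` and `⟪x i, x j⟫ ≤ 1/2` then
`⟪v i, s j⟫ + ⟪s i, v j⟫ ≤ ‖u i‖‖u j‖ + (‖u i‖² + ‖u j‖²)/4`. -/
theorem inner_tangentPart_free_le {si sj xi xj : E}
    (hss : ⟪si, sj⟫ = 1 / 2) (hxx : ⟪xi, xj⟫ ≤ 1 / 2) :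
    ⟪(xi - si) + (‖xi - si‖ ^ 2 / 2) • si, sj⟫ + ⟪si, (xj - sj) + (‖xj - sj‖ ^ 2 / 2) • sj⟫ ≤
      ‖xi - si‖ * ‖xj - sj‖ + (‖xi - si‖ ^ 2 + ‖xj - sj‖ ^ 2) / 4 := by
  have hkey : ⟪xi - si, sj⟫ + ⟪si, xj - sj⟫ + ⟪xi - si, xj - sj⟫ ≤ 0 := by
    have : ⟪xi, xj⟫ = ⟪si, sj⟫ + (⟪xi - si, sj⟫ + ⟪si, xj - sj⟫ + ⟪xi - si, xj - sj⟫) := by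
      rw [inner_sub_left, inner_sub_right, inner_sub_left, inner_sub_right, inner_sub_right]; ring
    linarith
  have hcs : -⟪xi - si, xj - sj⟫ ≤ ‖xi - si‖ * ‖xj - sj‖ := by
    have := abs_real_inner_le_norm (xi - si) (xj - sj)
    have := neg_abs_le ⟪xi - si, xj - sj⟫
    linarith
  rw [inner_add_left, real_inner_smul_left, inner_add_right, real_inner_smul_right, hss]
  nlinarith [hkey, hcs, sq_nonneg ‖xi - si‖, sq_nonneg ‖xj - sj‖]

/-- **The ε-tube lemma.**  Own balls `O` (any vectors; in the application unit vectors), exact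
slots `s : ι → E` (unit vectors) and an admissible completion `x : ι → E` (unit vectors,
`⟪x i, o⟫ ≤ 1/2` at the active own contacts of `s`, `⟪x i, x j⟫ ≤ 1/2` at the active free
contacts of `s`).  If the first-order cone of `s` has margin `κ ∈ (0, 3]` — for every tangent
field `v` and every index `i₀` some active contact is violated to first order by `≥ κ ‖v i₀‖` —
and every `x i` is within chord distance `< κ/3` of `s i`, then `x = s`: inside the tube the exact
completion is the only one. -/
theorem eq_of_coneMargin {ι : Type*} [Fintype ι] {s x : ι → E} {O : Finset E} {κ : ℝ}
    (hκ : 0 < κ) (hκ3 : κ ≤ 3)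
    (hs : ∀ i, ‖s i‖ = 1) (hx : ∀ i, ‖x i‖ = 1)
    (hxo : ∀ i, ∀ o ∈ O, ⟪s i, o⟫ = 1 / 2 → ⟪x i, o⟫ ≤ 1 / 2)
    (hxx : ∀ i j, i ≠ j → ⟪s i, s j⟫ = 1 / 2 → ⟪x i, x j⟫ ≤ 1 / 2)
    (hmargin : ∀ v : ι → E, (∀ i, ⟪v i, s i⟫ = 0) → ∀ i₀ : ι,
      (∃ i, ∃ o ∈ O, ⟪s i, o⟫ = 1 / 2 ∧ κ * ‖v i₀‖ ≤ ⟪v i, o⟫) ∨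
      (∃ i j, i ≠ j ∧ ⟪s i, s j⟫ = 1 / 2 ∧ κ * ‖v i₀‖ ≤ ⟪v i, s j⟫ + ⟪s i, v j⟫))
    (hclose : ∀ i, ‖x i - s i‖ < κ / 3) : x = s := by
  classical
  rcases isEmpty_or_nonempty ι with hι | hι
  · funext i; exact (hι.false i).elim
  -- the tangent field
  set v : ι → E := fun i => (x i - s i) + (‖x i - s i‖ ^ 2 / 2) • s i with hv
  have hvt : ∀ i, ⟪v i, s i⟫ = 0 := fun i => inner_tangentPart_eq_zero (hs i) (hx i)
  -- the maximal displacement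
  obtain ⟨i₀, hi₀⟩ := Finite.exists_max fun i => ‖x i - s i‖
  set ε := ‖x i₀ - s i₀‖ with hεdef
  have hε0 : 0 ≤ ε := norm_nonneg _
  have hεi : ∀ i, ‖x i - s i‖ ≤ ε := hi₀
  have hε1 : ε ≤ 1 := by have := hclose i₀; linarith
  -- lower bound at i₀
  have hlow : ε / 2 ≤ ‖v i₀‖ := half_norm_le_norm_tangentPart (hs i₀) (hx i₀) hε1
  -- upper bound on every active linearised constraint
  have hup : κ * ‖v i₀‖ ≤ 3 / 2 * ε ^ 2 := by
    rcases hmargin v hvt i₀ with ⟨i, o, ho, hso, hle⟩ | ⟨i, j, hij, hss, hle⟩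
    · have h1 : ⟪v i, o⟫ ≤ ‖x i - s i‖ ^ 2 / 4 := inner_tangentPart_own_le hso (hxo i o ho hso)
      have h2 : ‖x i - s i‖ ^ 2 ≤ ε ^ 2 := pow_le_pow_left₀ (norm_nonneg _) (hεi i) 2
      nlinarith
    · have h1 : ⟪v i, s j⟫ + ⟪s i, v j⟫ ≤
          ‖x i - s i‖ * ‖x j - s j‖ + (‖x i - s i‖ ^ 2 + ‖x j - s j‖ ^ 2) / 4 :=
        inner_tangentPart_free_le hss (hxx i j hij hss)
      have h2 : ‖x i - s i‖ ^ 2 ≤ ε ^ 2 := pow_le_pow_left₀ (norm_nonneg _) (hεi i) 2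
      have h3 : ‖x j - s j‖ ^ 2 ≤ ε ^ 2 := pow_le_pow_left₀ (norm_nonneg _) (hεi j) 2
      have h4 : ‖x i - s i‖ * ‖x j - s j‖ ≤ ε * ε :=
        mul_le_mul (hεi i) (hεi j) (norm_nonneg _) hε0
      nlinarith
  -- conclude ε = 0
  have hεz : ε = 0 := by
    by_contra hne
    have hpos : 0 < ε := lt_of_le_of_ne hε0 (Ne.symm hne)
    have : κ * (ε / 2) ≤ 3 / 2 * ε ^ 2 := le_trans (mul_le_mul_of_nonneg_left hlow hκ.le) hup
    have hκε : κ ≤ 3 * ε := by nlinarith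
    have := hclose i₀
    linarith
  funext i
  have : ‖x i - s i‖ ≤ 0 := by rw [← hεz]; exact hεi i
  have h0 : x i - s i = 0 := norm_le_zero_iff.1 this
  exact sub_eq_zero.1 h0

end Summit.Ventures.Crystal3D.Theorems

end
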